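import Literature.AnabelianGeometry.SemiGraphs.TemperedFunctorialityHomProofs
import Literature.AnabelianGeometry.SemiGraphs.TemperoidsHomEqResProofs
import HarnessLib

/-!
# The "collapse" of a semi-graph of anabelioids onto one profinite group, and the continuous
# homomorphism `π₁^temp(𝒢) → P` it induces (row O-Cor39-1 of the abc-iut cell, part 2)

Mochizuki, *Semi-graphs of anabelioids*, Publ. RIMS **42** (2006), §3: Def. 3.1 (iii) p. 33
(morphisms of temperoids), Prop. 3.2 p. 35, Def. 3.5 (ii) p. 37, Prop. 3.6 (iv) p. 39
[cite: MochizukiSemiAnbd2006, Prop 3.6(iv) p.39].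

PURPOSE.  The frozen literal rendering `ProfiniteSemiGraph.Cor39` of Cor. 3.9 uses the LITERAL reading
`IsQuasiGeometric` of Def. 3.8, which (finding t2g2-F1) admits "fold" homomorphisms
`π₁^temp(𝒢) → π₁^temp(ℋ)` that collapse an edge into a single verticial subgroup and are induced by no
morphism of semi-graphs of anabelioids; `TemperedReconstructionCor39LiteralFold.lean` reduces the refutation
of the literal `Cor39` to the existence of one such homomorphism at a finite Cor-3.9 pair.  This file
CONSTRUCTS the source of fold homomorphisms in general: a *collapse datum* of `𝒢` onto a topological group
`P` — continuous homomorphisms `κ_v : Π_v → P`, `λ_e : Π_e → P` and elements `τ_b ∈ P` with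
`τ_b · λ_e · τ_b⁻¹ = κ_v ∘ b_*` along every branch `b : e → v` (the data of a morphism of semi-graphs of
anabelioids from `𝒢` to "a single anabelioid `B(P)`", edges included, with the 2-cells `τ_b` EXPLICIT) —
induces, exactly as in the construction of `Hom.covPullback` (abc-iut-L3-d4/L3-t10), a pull-back functor
`B^temp(P) ⥤ B^cov(𝒢)`, `X ↦ (X|_{κ_v}, X|_{λ_e}; glued along b by the action of τ_b)`:

* `CollapseDatum`, `CollapseDatum.functor` — the datum and the functor; `functor_comp_restrictV/E`
  (restriction to `v` / `e` after collapsing IS restriction of scalars along `κ_v` / `λ_e`, definitional);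
* `preservesLimitsOfShape_functor`, `preservesColimitsOfShape_functor` — finite limits and countable
  colimits (detected fibre by fibre, abc-iut-L3-t10's `CovObj.isLimitOfComponents`);
* `exists_eq_ρ_of_sameComponent`, `isTempered_obj` — for `P` profinite every collapsed object is
  TEMPERED (Def. 3.5 (ii)): the component of a point lies in its `P`-orbit, which is split by the finite
  object collapsed from `P/N`, `N` an open normal subgroup inside the stabiliser;
* `btempFunctor`, `chartFunctor`, `chartTemperoidHom` — the morphism of temperoids
  `B^temp(P) → B^temp(π₁^temp 𝒢)` through a chart;
* **`exists_collapseHom`** — Prop. 3.2 (`TemperoidHomEqRes_holds`, abc-iut-L3-d2): a continuous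
  `ψ : π₁^temp(𝒢) → P` with `B^temp(ψ) ≅` the collapse functor; **`conj_κ_of_chartFunctor_iso`** — such a
  `ψ` restricted along any verticial homomorphism at `v` is `P`-conjugate to `κ_v` (and along any edge
  homomorphism at `e`, to `λ_e`).

Definitions here are non-`Prop` plumbing (a data structure and functors); no named fact is introduced and no
statement of the tree is edited.  Nothing here takes a side on [IUTchIII] Cor. 3.12.
-/

noncomputable section

namespace Literature.AnabelianGeometry.SemiGraphs

namespace ProfiniteSemiGraph

open CategoryTheory CategoryTheory.Limits Topology

universe u

variable {𝒢 : ProfiniteSemiGraph.{u}} {P : Type u} [Group P] [TopologicalSpace P] [IsTopologicalGroup P]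

/-- A **collapse datum** of `𝒢` onto the topological group `P`: continuous homomorphisms of all vertex and
edge groups into `P`, compatible with the branch maps up to the EXPLICIT conjugating elements `τ_b`
(`τ_b · λ_e(x) · τ_b⁻¹ = κ_v (b_* x)` for `b : e → v`) — the data of a morphism from `𝒢` to the semi-graph
of anabelioids with one constituent `B(P)`, 2-cells included (cf. Rmk. 2.4.2 p. 26: the compatibility of a
morphism with the `b_*` holds up to conjugation). [cite: MochizukiSemiAnbd2006, Rmk 2.4.2 p.26] -/
structure CollapseDatum (𝒢 : ProfiniteSemiGraph.{u}) (P : Type u) [Group P] [TopologicalSpace P]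
    [IsTopologicalGroup P] : Type u where
  /-- the vertex homomorphisms `κ_v : Π_v → P` -/
  κ : ∀ v : 𝒢.graph.Vertex, 𝒢.Gv v →ₜ* P
  /-- the edge homomorphisms `λ_e : Π_e → P` -/
  lam : ∀ e : 𝒢.graph.Edge, 𝒢.Ge e →ₜ* P
  /-- the conjugating element along the branch `b : e → v` -/
  τ : ∀ (b : 𝒢.graph.Branch) (v : 𝒢.graph.Vertex), 𝒢.graph.abuts b = some v → P
  /-- `τ_b · λ_e · τ_b⁻¹ = κ_v ∘ b_*` -/
  comm : ∀ (b : 𝒢.graph.Branch) (v : 𝒢.graph.Vertex) (h : 𝒢.graph.abuts b = some v)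
    (x : 𝒢.Ge (𝒢.graph.edgeOf b)),
    τ b v h * lam (𝒢.graph.edgeOf b) x * (τ b v h)⁻¹ = ((κ v).comp (𝒢.brHom b v h)) x

namespace CollapseDatum

variable (D : CollapseDatum 𝒢 P)

/-! ### The collapse functor `B^temp(P) ⥤ B^cov(𝒢)` -/

/-- The gluing of the collapse along a branch `b : e → v`, as a natural isomorphism
`B^temp(λ_e) ≅ B^temp(κ_v) ⋙ B^temp(b_*)` of functors `B^temp(P) ⥤ B^temp(Π_e)`: the isomorphism of
pull-backs along the conjugate homomorphisms `λ_e`, `κ_v ∘ b_*` (action of `τ_b`), then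
`B^temp(κ_v ∘ b_*) = B^temp(κ_v) ⋙ B^temp(b_*)`. [cite: MochizukiSemiAnbd2006, Prop 3.6(iv) p.39] -/
def gluingIso (b : 𝒢.graph.Branch) (v : 𝒢.graph.Vertex) (h : 𝒢.graph.abuts b = some v) :
    BTemp.res (D.lam (𝒢.graph.edgeOf b)) ≅ BTemp.res (D.κ v) ⋙ BTemp.res (𝒢.brHom b v h) :=
  BTemp.resIsoOfConj (D.lam (𝒢.graph.edgeOf b)) ((D.κ v).comp (𝒢.brHom b v h)) (D.τ b v h)
      (D.comm b v h) ≪≫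
    (BTemp.resComp (D.κ v) (𝒢.brHom b v h)).symm

/-- The collapsed object `(X|_{κ_v}, X|_{λ_e}; τ)` of `B^cov(𝒢)` attached to `X ∈ B^temp(P)`.
[cite: MochizukiSemiAnbd2006, Prop 3.6(iv) p.39] -/
def obj (X : BTemp P) : CovObj 𝒢 where
  SV v := (BTemp.res (D.κ v)).obj X
  SE e := (BTemp.res (D.lam e)).obj X
  glue b v h := (D.gluingIso b v h).app X

/-- The collapse of a morphism of `B^temp(P)` (componentwise the same map); compatibility with the
gluings is the naturality of `gluingIso`. [cite: MochizukiSemiAnbd2006, Prop 3.6(iv) p.39] -/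
def map {X Y : BTemp P} (f : X ⟶ Y) : D.obj X ⟶ D.obj Y where
  fV v := (BTemp.res (D.κ v)).map f
  fE e := (BTemp.res (D.lam e)).map f
  comm b v h := (D.gluingIso b v h).hom.naturality f

/-- **The collapse functor** `B^temp(P) ⥤ B^cov(𝒢)` of a collapse datum.
[cite: MochizukiSemiAnbd2006, Prop 3.6(iv) p.39] -/
def functor : BTemp P ⥤ CovObj 𝒢 where
  obj X := D.obj X
  map f := D.map f
  map_id X := by
    refine CovHom.ext ?_ ?_ <;> funext _ <;> simp [CollapseDatum.map, CollapseDatum.obj]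
  map_comp f g := by
    refine CovHom.ext ?_ ?_ <;> funext _
    · exact (BTemp.res _).map_comp _ _
    · exact (BTemp.res _).map_comp _ _

/-- Restricting the collapse to the vertex `v` IS restriction of scalars along `κ_v` (definitional).
[cite: MochizukiSemiAnbd2006, Prop 3.6(iv) p.39] -/
theorem functor_comp_restrictV (v : 𝒢.graph.Vertex) : D.functor ⋙ restrictV 𝒢 v = BTemp.res (D.κ v) :=
  rfl

/-- Restricting the collapse to the edge `e` IS restriction of scalars along `λ_e` (definitional).
[cite: MochizukiSemiAnbd2006, Prop 3.6(iv) p.39] -/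
theorem functor_comp_restrictE (e : 𝒢.graph.Edge) : D.functor ⋙ restrictE 𝒢 e = BTemp.res (D.lam e) :=
  rfl

/-- The gluing of a collapsed object along `b` is the action of `τ_b`.
[cite: MochizukiSemiAnbd2006, Prop 3.6(iv) p.39] -/
theorem functor_glue_apply (X : BTemp P) (b : 𝒢.graph.Branch) (v : 𝒢.graph.Vertex)
    (h : 𝒢.graph.abuts b = some v) (x : X.obj.V) :
    ((D.functor.obj X).glue b v h).hom.hom.hom x = X.obj.ρ (D.τ b v h) x :=
  rfl

/-! ### Exactness: finite limits and countable colimits -/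

/-- The collapse functor preserves finite limits (they are detected fibre by fibre in `B^cov(𝒢)`, and
fibre by fibre the collapse is a restriction of scalars). [cite: MochizukiSemiAnbd2006, Def 3.1(iii) p.33] -/
theorem preservesLimitsOfShape_functor (J : Type) [SmallCategory J] [FinCategory J] :
    PreservesLimitsOfShape J D.functor := by
  haveI : ∀ v, PreservesLimitsOfShape J (BTemp.res (D.κ v)) :=
    fun v => btempRes_preservesLimitsOfShape (D.κ v) J
  haveI : ∀ e, PreservesLimitsOfShape J (BTemp.res (D.lam e)) :=
    fun e => btempRes_preservesLimitsOfShape (D.lam e) J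
  refine ⟨fun {K} => ⟨fun {c} hc => CovObj.isLimitOfComponents _ (fun v => ?_) (fun e => ?_)⟩⟩
  · change IsLimit ((D.functor ⋙ restrictV 𝒢 v).mapCone c)
    rw [D.functor_comp_restrictV v]
    exact isLimitOfPreserves _ hc
  · change IsLimit ((D.functor ⋙ restrictE 𝒢 e).mapCone c)
    rw [D.functor_comp_restrictE e]
    exact isLimitOfPreserves _ hc

/-- The collapse functor preserves countable colimits. [cite: MochizukiSemiAnbd2006, Def 3.1(iii) p.33] -/
theorem preservesColimitsOfShape_functor (J : Type) [SmallCategory J] [CountableCategory J] :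
    PreservesColimitsOfShape J D.functor := by
  haveI : ∀ v, PreservesColimitsOfShape J (BTemp.res (D.κ v)) :=
    fun v => btempRes_preservesColimitsOfShape (D.κ v) J
  haveI : ∀ e, PreservesColimitsOfShape J (BTemp.res (D.lam e)) :=
    fun e => btempRes_preservesColimitsOfShape (D.lam e) J
  refine ⟨fun {K} => ⟨fun {c} hc => CovObj.isColimitOfComponents _ (fun v => ?_) (fun e => ?_)⟩⟩
  · change IsColimit ((D.functor ⋙ restrictV 𝒢 v).mapCocone c)
    rw [D.functor_comp_restrictV v]
    exact isColimitOfPreserves _ hc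
  · change IsColimit ((D.functor ⋙ restrictE 𝒢 e).mapCocone c)
    rw [D.functor_comp_restrictE e]
    exact isColimitOfPreserves _ hc

/-! ### Temperedness of collapsed objects (for `P` profinite) -/

omit [TopologicalSpace P] [IsTopologicalGroup P] in
/-- Multiplicativity of an action, pointwise. [folklore] -/
private theorem ρ_mul_apply' (X : Action (Type u) P) (g g' : P) (x : X.V) :
    X.ρ (g * g') x = X.ρ g (X.ρ g' x) := by
  rw [map_mul]; rfl

omit [TopologicalSpace P] [IsTopologicalGroup P] in
/-- The unit acts trivially, pointwise. [folklore] -/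
private theorem ρ_one_apply' (X : Action (Type u) P) (x : X.V) : X.ρ 1 x = x := by
  rw [map_one]; rfl

/-- The underlying point of `X` of a point of the collapsed object (every fibre of `D.functor.obj X` is
the set `X` itself). [cite: MochizukiSemiAnbd2006, Def 3.5(ii) p.37] -/
def pointVal (X : BTemp P) : (D.functor.obj X).Point → X.obj.V
  | Sum.inl q => q.2
  | Sum.inr q => q.2

/-- **The connected component of a point of a collapsed object lies in its `P`-orbit**: all the moves
generating `SameComponent` (action of `Π_v` through `κ_v`, of `Π_e` through `λ_e`, gluing = action of
`τ_b`) are actions of elements of `P`. [cite: MochizukiSemiAnbd2006, Def 3.5(ii) p.37] -/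
theorem exists_eq_ρ_of_sameComponent (X : BTemp P) {p q : (D.functor.obj X).Point}
    (hpq : (D.functor.obj X).SameComponent p q) :
    ∃ g : P, D.pointVal X q = X.obj.ρ g (D.pointVal X p) := by
  induction hpq with
  | rel a b hab =>
    cases hab with
    | vertex v g x => exact ⟨D.κ v g, rfl⟩
    | edge e g x => exact ⟨D.lam e g, rfl⟩
    | glue b v h x => exact ⟨D.τ b v h, rfl⟩
  | refl a => exact ⟨1, (ρ_one_apply' X.obj _).symm⟩
  | symm a b _ ih =>
    obtain ⟨g, hg⟩ := ih
    refine ⟨g⁻¹, ?_⟩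
    rw [hg, ← ρ_mul_apply', inv_mul_cancel, ρ_one_apply']
  | trans a b c _ _ ih₁ ih₂ =>
    obtain ⟨g₁, h₁⟩ := ih₁
    obtain ⟨g₂, h₂⟩ := ih₂
    exact ⟨g₂ * g₁, by rw [h₂, h₁, ρ_mul_apply']⟩

omit [TopologicalSpace P] [IsTopologicalGroup P] in
/-- An element of a normal subgroup `N` contained in the stabiliser of `x₀` fixes every point of the
`P`-orbit of `x₀`. [folklore] -/
private theorem ρ_eq_of_mem_normal (X : Action (Type u) P) {x₀ : X.V} (N : Subgroup P) [N.Normal]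
    (hN : ∀ n ∈ N, X.ρ n x₀ = x₀) {n : P} (hn : n ∈ N) (g : P) :
    X.ρ n (X.ρ g x₀) = X.ρ g x₀ := by
  have h : g⁻¹ * n * g ∈ N := by
    simpa [mul_assoc] using Subgroup.Normal.conj_mem' inferInstance n hn g
  have h1 := hN _ h
  rw [ρ_mul_apply', ρ_mul_apply'] at h1
  have h2 := congrArg (X.ρ g) h1
  rwa [← ρ_mul_apply' X g g⁻¹, mul_inv_cancel, ρ_one_apply'] at h2

omit [TopologicalSpace P] [IsTopologicalGroup P] in
/-- If `h • (q N) = q N` in `P/N` for a normal subgroup `N`, then `h ∈ N`. [folklore] -/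
private theorem mem_of_smul_quotient_eq {N : Subgroup P} [N.Normal] {h : P} {x : P ⧸ N}
    (hx : h • x = x) : h ∈ N := by
  induction x using QuotientGroup.induction_on with
  | H q =>
    rw [MulAction.Quotient.smul_mk, QuotientGroup.eq] at hx
    -- `(h q)⁻¹ q = q⁻¹ h⁻¹ q ∈ N`, so `h⁻¹ ∈ N`
    have : q * (q⁻¹ * h⁻¹ * q) * q⁻¹ ∈ N := Subgroup.Normal.conj_mem inferInstance _ (by
      simpa [mul_assoc] using hx) q
    have h' : h⁻¹ ∈ N := by simpa [mul_assoc] using this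
    simpa using N.inv_mem h'

/-- **Collapsed objects are tempered** (Def. 3.5 (ii)) when `P` is profinite: the component of a point
`p` (value `x₀ ∈ X`) lies in `P·x₀`; an open normal `N ≤ Stab(x₀)` exists, and the FINITE collapsed object
of `P/N` (nonempty fibres) splits the collapsed `X` at every point of `P·x₀` — an element of `Π_v` (resp.
`Π_e`) fixing a coset in `P/N` maps into `N`, which fixes `P·x₀` pointwise.
[cite: MochizukiSemiAnbd2006, Def 3.5(ii) p.37] -/
theorem isTempered_obj [CompactSpace P] [TotallyDisconnectedSpace P] (hP : IsTempered P)
    (X : BTemp P) : (D.functor.obj X).IsTempered := by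
  intro p
  set x₀ : X.obj.V := D.pointVal X p with hx₀
  -- an open normal subgroup inside the (open) stabiliser of `x₀`
  obtain ⟨N, hN⟩ := ProfiniteGrp.exist_openNormalSubgroup_sub_open_nhds_of_one (X.property.2 x₀)
    (show (1 : P) ∈ {g : P | X.obj.ρ g x₀ = x₀} from ρ_one_apply' X.obj x₀)
  have hNstab : ∀ n ∈ N.toSubgroup, X.obj.ρ n x₀ = x₀ := fun n hn => hN hn
  haveI : N.toSubgroup.Normal := N.isNormal'
  -- the finite object collapsed from `P/N`
  let Q : BTemp P := BTemp.quotientObj P hP N.toSubgroup N.isOpen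
  haveI : Finite (P ⧸ N.toSubgroup) := Subgroup.quotient_finite_of_isOpen _ N.isOpen
  refine ⟨D.functor.obj Q, ⟨fun _ => ‹Finite (P ⧸ N.toSubgroup)›, fun _ => ‹Finite (P ⧸ N.toSubgroup)›⟩,
    ⟨fun _ => ⟨((1 : P) : P ⧸ N.toSubgroup)⟩, fun _ => ⟨((1 : P) : P ⧸ N.toSubgroup)⟩⟩, fun q hpq => ?_⟩
  obtain ⟨g₀, hg₀⟩ := D.exists_eq_ρ_of_sameComponent X hpq
  rcases q with ⟨v, s⟩ | ⟨e, s⟩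
  · rintro (x : P ⧸ N.toSubgroup) g hgx
    change (Action.ofMulAction P (P ⧸ N.toSubgroup)).ρ (D.κ v g) x = x at hgx
    rw [Action.ofMulAction_apply] at hgx
    change X.obj.ρ (D.κ v g) s = s
    change s = X.obj.ρ g₀ x₀ at hg₀
    rw [hg₀]
    exact ρ_eq_of_mem_normal X.obj N.toSubgroup hNstab (mem_of_smul_quotient_eq hgx) g₀
  · rintro (x : P ⧸ N.toSubgroup) g hgx
    change (Action.ofMulAction P (P ⧸ N.toSubgroup)).ρ (D.lam e g) x = x at hgx
    rw [Action.ofMulAction_apply] at hgx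
    change X.obj.ρ (D.lam e g) s = s
    change s = X.obj.ρ g₀ x₀ at hg₀
    rw [hg₀]
    exact ρ_eq_of_mem_normal X.obj N.toSubgroup hNstab (mem_of_smul_quotient_eq hgx) g₀

/-! ### The morphism of temperoids `B^temp(P) → B^temp(𝒢)` and the collapse homomorphism -/

section Chart

variable [CompactSpace P] [TotallyDisconnectedSpace P] (hP : IsTempered P)

/-- The collapse functor into the tempered coverings `B^temp(𝒢)`.
[cite: MochizukiSemiAnbd2006, Prop 3.6(iv) p.39] -/
def btempFunctor : BTemp P ⥤ BTempCat 𝒢 :=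
  ObjectProperty.lift _ D.functor fun X => D.isTempered_obj hP X

/-- `btempFunctor` lies over `functor` (definitional). [cite: MochizukiSemiAnbd2006, Prop 3.6(iv) p.39] -/
theorem btempFunctor_comp_ι : D.btempFunctor hP ⋙ ObjectProperty.ι _ = D.functor := rfl

/-- `btempFunctor` preserves finite limits. [cite: MochizukiSemiAnbd2006, Def 3.1(iii) p.33] -/
theorem preservesLimitsOfShape_btempFunctor (J : Type) [SmallCategory J] [FinCategory J] :
    PreservesLimitsOfShape J (D.btempFunctor hP) := by
  haveI := isTempered_isClosedUnderLimitsOfShape (𝒢 := 𝒢) J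
  haveI := CovObj.hasLimitsOfShape_bTemp P J
  haveI := CovObj.hasLimitsOfShape (𝒢 := 𝒢) (J := J)
  haveI := D.preservesLimitsOfShape_functor J
  haveI : PreservesLimitsOfShape J (D.btempFunctor hP ⋙ ObjectProperty.ι _) := by
    rw [D.btempFunctor_comp_ι hP]
    infer_instance
  exact preservesLimitsOfShape_of_reflects_of_preserves (D.btempFunctor hP) (ObjectProperty.ι _)

/-- `btempFunctor` preserves countable colimits. [cite: MochizukiSemiAnbd2006, Def 3.1(iii) p.33] -/
theorem preservesColimitsOfShape_btempFunctor (J : Type) [SmallCategory J] [CountableCategory J] :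
    PreservesColimitsOfShape J (D.btempFunctor hP) := by
  haveI := isTempered_isClosedUnderColimitsOfShape (𝒢 := 𝒢) J
  haveI := CovObj.hasColimitsOfShape_bTemp P J
  haveI := CovObj.hasColimitsOfShape (𝒢 := 𝒢) (J := J)
  haveI := D.preservesColimitsOfShape_functor J
  haveI : PreservesColimitsOfShape J (D.btempFunctor hP ⋙ ObjectProperty.ι _) := by
    rw [D.btempFunctor_comp_ι hP]
    infer_instance
  exact preservesColimitsOfShape_of_reflects_of_preserves (D.btempFunctor hP) (ObjectProperty.ι _)

/-- The collapse functor through a chart: `B^temp(P) ⥤ B^temp(π₁^temp 𝒢)`.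
[cite: MochizukiSemiAnbd2006, Prop 3.6(iv) p.39] -/
def chartFunctor (c : TemperedPiChart 𝒢) : BTemp P ⥤ BTemp c.G :=
  D.btempFunctor hP ⋙ c.equiv.functor

/-- The collapse as a morphism of connected temperoids `B^temp(P) → B^temp(π₁^temp 𝒢)` (the input of
Prop. 3.2). [cite: MochizukiSemiAnbd2006, Def 3.1(iii) p.33] -/
def chartTemperoidHom (c : TemperedPiChart 𝒢) : TemperoidHom (BTemp c.G) (BTemp P) where
  pullback := D.chartFunctor hP c
  preservesFiniteLimits := ⟨fun J _ _ => by
    haveI := D.preservesLimitsOfShape_btempFunctor hP J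
    unfold chartFunctor
    infer_instance⟩
  preservesCountableColimits J _ _ := by
    haveI := D.preservesColimitsOfShape_btempFunctor hP J
    unfold chartFunctor
    infer_instance

/-- **The collapse homomorphism** (Prop. 3.2, surjectivity half, abc-iut-L3-d2's `TemperoidHomEqRes_holds`):
a continuous `ψ : π₁^temp(𝒢) → P` whose pull-back functor is the collapse.
[cite: MochizukiSemiAnbd2006, Prop 3.2 p.35] -/
theorem exists_collapseHom [SecondCountableTopology P] (c : TemperedPiChart 𝒢) :
    ∃ ψ : c.G →ₜ* P, Nonempty (D.chartFunctor hP c ≅ BTemp.res ψ) := by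
  haveI := c.secondCountableTopology
  exact TemperoidHomEqRes_holds c.G P c.isTempered hP (D.chartTemperoidHom hP c)

/-- **Compatibility with the verticial homomorphisms**: if `B^temp(ψ) ≅` the collapse functor, then for
every verticial homomorphism `ι` of `𝒢` at `v` the composite `ψ ∘ ι : Π_v → P` is `P`-conjugate to `κ_v`
(both pull back to the restriction `X ↦ X|_{κ_v}`; Prop. 3.2, injectivity half).
[cite: MochizukiSemiAnbd2006, Prop 3.6(iv) p.39] -/
theorem conj_κ_of_chartFunctor_iso (c : TemperedPiChart 𝒢) (ψ : c.G →ₜ* P)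
    (hψ : Nonempty (D.chartFunctor hP c ≅ BTemp.res ψ)) (v : 𝒢.graph.Vertex) (ι : 𝒢.Gv v →ₜ* c.G)
    (hι : IsVerticialHom c v ι) : ∃ g : P, ∀ x, ψ (ι x) = g * D.κ v x * g⁻¹ := by
  obtain ⟨e⟩ := hψ
  obtain ⟨e'⟩ := hι
  let s3 : D.btempFunctor hP ⋙ (c.equiv.functor ⋙ BTemp.res ι) ≅
      D.btempFunctor hP ⋙ (c.equiv.functor ⋙ (c.equiv.inverse ⋙ ObjectProperty.ι _ ⋙ restrictV 𝒢 v)) :=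
    Functor.isoWhiskerLeft _ (Functor.isoWhiskerLeft _ e'.symm)
  let s4 : D.btempFunctor hP ⋙ (c.equiv.functor ⋙ (c.equiv.inverse ⋙ ObjectProperty.ι _ ⋙ restrictV 𝒢 v)) ≅
      D.btempFunctor hP ⋙ (ObjectProperty.ι _ ⋙ restrictV 𝒢 v) :=
    Functor.isoWhiskerLeft _ ((Functor.associator _ _ _).symm ≪≫
      Functor.isoWhiskerRight c.equiv.unitIso.symm _ ≪≫ Functor.leftUnitor _)
  let s5 : D.btempFunctor hP ⋙ (ObjectProperty.ι _ ⋙ restrictV 𝒢 v) ≅ BTemp.res (D.κ v) := Iso.refl _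
  let η : BTemp.res (ψ.comp ι) ≅ BTemp.res (D.κ v) :=
    (BTemp.resComp ψ ι).symm ≪≫ Functor.isoWhiskerRight e.symm (BTemp.res ι) ≪≫
      Functor.associator _ _ _ ≪≫ s3 ≪≫ s4 ≪≫ s5
  obtain ⟨g, hg, -⟩ := BTemp.exists_conj_of_natTrans hP (ψ.comp ι) (D.κ v) η.hom
  refine ⟨g⁻¹, fun x => ?_⟩
  have h := hg x
  change g * ψ (ι x) * g⁻¹ = D.κ v x at h
  rw [← h]
  group

/-- Edge version: `ψ ∘ λ'` is `P`-conjugate to `λ_e` for every edge homomorphism `λ'` of `𝒢` at `e`.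
[cite: MochizukiSemiAnbd2006, Prop 3.6(iv) p.39] -/
theorem conj_lam_of_chartFunctor_iso (c : TemperedPiChart 𝒢) (ψ : c.G →ₜ* P)
    (hψ : Nonempty (D.chartFunctor hP c ≅ BTemp.res ψ)) (e : 𝒢.graph.Edge) (ι : 𝒢.Ge e →ₜ* c.G)
    (hι : IsEdgeHom c e ι) : ∃ g : P, ∀ x, ψ (ι x) = g * D.lam e x * g⁻¹ := by
  obtain ⟨e₀⟩ := hψ
  obtain ⟨e'⟩ := hι
  let s3 : D.btempFunctor hP ⋙ (c.equiv.functor ⋙ BTemp.res ι) ≅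
      D.btempFunctor hP ⋙ (c.equiv.functor ⋙ (c.equiv.inverse ⋙ ObjectProperty.ι _ ⋙ restrictE 𝒢 e)) :=
    Functor.isoWhiskerLeft _ (Functor.isoWhiskerLeft _ e'.symm)
  let s4 : D.btempFunctor hP ⋙ (c.equiv.functor ⋙ (c.equiv.inverse ⋙ ObjectProperty.ι _ ⋙ restrictE 𝒢 e)) ≅
      D.btempFunctor hP ⋙ (ObjectProperty.ι _ ⋙ restrictE 𝒢 e) :=
    Functor.isoWhiskerLeft _ ((Functor.associator _ _ _).symm ≪≫
      Functor.isoWhiskerRight c.equiv.unitIso.symm _ ≪≫ Functor.leftUnitor _)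
  let s5 : D.btempFunctor hP ⋙ (ObjectProperty.ι _ ⋙ restrictE 𝒢 e) ≅ BTemp.res (D.lam e) := Iso.refl _
  let η : BTemp.res (ψ.comp ι) ≅ BTemp.res (D.lam e) :=
    (BTemp.resComp ψ ι).symm ≪≫ Functor.isoWhiskerRight e₀.symm (BTemp.res ι) ≪≫
      Functor.associator _ _ _ ≪≫ s3 ≪≫ s4 ≪≫ s5
  obtain ⟨g, hg, -⟩ := BTemp.exists_conj_of_natTrans hP (ψ.comp ι) (D.lam e) η.hom
  refine ⟨g⁻¹, fun x => ?_⟩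
  have h := hg x
  change g * ψ (ι x) * g⁻¹ = D.lam e x at h
  rw [← h]
  group

end Chart

end CollapseDatum

end ProfiniteSemiGraph

end Literature.AnabelianGeometry.SemiGraphs

end
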